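import Summits.ValiantsHypothesis.ValiantsHypothesis.Theses.Elusive
import Summits.ValiantsHypothesis.ValiantsHypothesis.Theorems.ElusiveRefutations

/-!
# Refutation of the route item `Elusive.ElusiveCandidate` (stmt-ValiantsHypothesis-0340)

The Sidon-exponent moment curve is swallowed by a ruled quadratic map for every m ≥ 7
(`Summit.ValiantsHypothesis.Elusive.not_elusive_candidate`); restated here with type literally
`¬ Summit.ValiantsHypothesis.ValiantsHypothesis.Theses.Elusive.ElusiveCandidate` (refuter g41-40).
-/

/-- Refutes `Elusive.ElusiveCandidate` (stmt-ValiantsHypothesis-0340): the Sidon-exponent moment curve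
x ↦ (x^{d_i})_{i<m}, d_i = (i+1)(2m²+1) + (i+1)², is NOT (m−1,2)-elusive for m ≥ 7 — the ruled quadratic map
built from the 3-vs-3 exponent coincidence d₀+d₄+d₅ = d₁+d₂+d₆ swallows it
(`Summit.ValiantsHypothesis.Elusive.not_elusive_candidate`, in tree). This file only restates that theorem
against the route declaration so the ledger item can close as refuted. [folklore] -/
theorem Summit.ValiantsHypothesis.Elusive.ElusiveElusiveCandidate_refuted :
    ¬ Summit.ValiantsHypothesis.ValiantsHypothesis.Theses.Elusive.ElusiveCandidate :=
  Summit.ValiantsHypothesis.Elusive.not_elusive_candidate
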